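import Literature.AlgebraicGeometry.RelativeSpec.EquivariantModuleInvariants
import Literature.AlgebraicGeometry.Modules.IsoOfAffineCover
import Literature.RingTheory.GaloisAlgebras.ChaseHarrisonRosenbergDescent
import HarnessLib

/-!
# Galois descent of quasi-coherent modules along a free finite quotient

Let `p : X ⟶ Q` be an AFFINE GEOMETRIC QUOTIENT of the scheme `X` by a finite group `G`
(`ρ : ActionOver p G`, `ρ.IsGeometricQuotient p`, `IsAffineHom p`; e.g. the tree's
`ActionOver.toQuotient`) whose action is FREE on the affine charts: for `V ⊆ Q` affine and
`g ≠ 1` the elements `g · b - b`, `b ∈ Γ(X, p⁻¹V)`, generate the unit ideal (the hypothesis of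
`RelativeSpec/FreeQuotient`; Chase–Harrison–Rosenberg). Then for every quasi-coherent `E` on `X`
with a `G`-equivariant structure `φ` (`RelativeSpec/EquivariantModuleInvariants`):

* `ActionOver.descentHom_app_bijective` — the comparison `p^* (p_* E)^G ⟶ E` is bijective on
  the sections over every `p⁻¹V`, `V` affine: with `A = Γ(Q, V) ↪ B = Γ(X, p⁻¹V)` (`B^G = A`,
  free action) and `M = Γ(E, p⁻¹V)` with its descent datum `g • m = g⁻¹ · m`, this is the
  Chase–Harrison–Rosenberg descent `B ⊗_A M^G ≅ M`
  (`GaloisAlgebras.isBaseChange_of_free`, Greither LNM 1534 Ch. 0 Thm. 7.1) read through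
  `Γ(p^* F, p⁻¹V) = B · η(Γ(F, V))` (`Modules/PullbackPushforwardTraceChart.pullback_sections_induction`);
* `ActionOver.isIso_descentHom` — hence `p^* (p_* E)^G ≅ E` (`Modules/IsoOfAffineCover`);
* `ActionOver.pullback_map_descentHom_comp` — the isomorphism intertwines the canonical
  equivariant structure of the pull-back `(ρ.aut g)^* p^* F ≅ (ρ.aut g ≫ p)^* F = p^* F` with `φ`;
* **`ActionOver.exists_descent_of_free`** — the existence statement: `E ≅ p^* F` compatibly, for
  the quasi-coherent `F = (p_* E)^G` on `Q`.

This is the descent of quasi-coherent sheaves along the `G`-torsor `X → X/G` ([MFK94] Prop. 7.1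
for a principal bundle with finite structure group; Mumford, *Abelian Varieties* §12 Thm. 1;
SGA 1 VIII 1.1 for the finite locally free covering `p`), in the print-shaped form "the functor
`F ↦ p^* F` from quasi-coherent modules on `X/G` to `G`-equivariant quasi-coherent modules on `X`
is essentially surjective". Everything is proved; no named facts.

## References

* [MumfordAV1970] D. Mumford, *Abelian Varieties* (1970), §7 Thm. p. 66 and Thm. 4 (p. 72),
  §12 Thm. 1 (p. 112).
* [MumfordFogartyKirwan1994] D. Mumford, J. Fogarty, F. Kirwan, *Geometric Invariant Theory*,
  3rd ed. (1994), Ch. 0 §4 Prop. 0.9 / Ch. 7 Prop. 7.1 (descent for principal bundles).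
* [Greither1992CyclicGalois] C. Greither, LNM 1534 (1992), Ch. 0 Thm. 7.1, Prop. 7.2 (pp. 28–29).
-/

noncomputable section

-- `TopCat.Presheaf`/`Scheme.Modules` are not reducible (as in Mathlib's `AlgebraicGeometry/Modules`).
set_option backward.isDefEq.respectTransparency false

universe u

open CategoryTheory Limits AlgebraicGeometry TopologicalSpace Opposite
open Literature.AlgebraicGeometry.Modules

namespace Literature.AlgebraicGeometry.RelativeSpec.ActionOver

variable {X Q : Scheme.{u}} {p : X ⟶ Q} {G : Type u} [Group G] (ρ : ActionOver p G)
variable (E : X.Modules) (φ : ∀ g : G, (Scheme.Modules.pullback (ρ.aut g).hom).obj E ≅ E)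
variable [Fintype G]

/-! ### Bijectivity on the affine charts `p⁻¹V` -/

/-- **The comparison `p^*(p_*E)^G ⟶ E` is bijective on the sections over `p⁻¹V`** for every
affine open `V` of an affine geometric quotient `p : X ⟶ Q` by a free action — this is the
Chase–Harrison–Rosenberg descent `B ⊗_A M^G ≅ M` (`GaloisAlgebras.isBaseChange_of_free`) for
`A = Γ(Q, V) ↪ B = Γ(X, p⁻¹V)`, `M = Γ(E, p⁻¹V)`, read through `Γ(p^*F, p⁻¹V) = B ⊗_A Γ(F, V)`
(`pullback_sections_induction`). [cite: Greither1992CyclicGalois, Ch. 0 Thm. 7.1 (pp. 28–29)] -/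
theorem descentHom_app_bijective [IsAffineHom p] (hq : ρ.IsGeometricQuotient p)
    (hfree : ∀ (V : Q.Opens), IsAffineOpen V → ∀ g : G, g ≠ 1 →
      Ideal.span (Set.range fun b : Γ(X, p ⁻¹ᵁ V) ↦ ρ.act g V b - b) = ⊤)
    (hE : IsAffineLocalizing E)
    (hunit : (φ 1).hom = ((Scheme.Modules.pullbackCongr ρ.aut_one_hom).app E).hom ≫
      ((Scheme.Modules.pullbackId X).app E).hom)
    (hcocycle : ∀ g h : G, (φ (g * h)).hom =
      ((Scheme.Modules.pullbackCongr (ρ.aut_mul_hom g h)).app E).hom ≫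
        ((Scheme.Modules.pullbackComp (ρ.aut h).hom (ρ.aut g).hom).app E).inv ≫
          (Scheme.Modules.pullback (ρ.aut h).hom).map (φ g).hom ≫ (φ h).hom)
    {V : Q.Opens} (hV : IsAffineOpen V) :
    Function.Bijective ((ρ.descentHom E φ).app (p ⁻¹ᵁ V)) := by
  classical
  -- notation
  set F := ρ.moduleInvariants E φ with hF
  set ι := ρ.moduleInvariantsι E φ with hι
  -- the rings `A = Γ(Q, V) → B = Γ(X, p⁻¹V)` with the free `G`-action on `B`
  letI : Algebra Γ(Q, V) Γ(X, p ⁻¹ᵁ V) := (p.app V).hom.toAlgebra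
  letI : MulSemiringAction G Γ(X, p ⁻¹ᵁ V) := ρ.mulSemiringAction V
  haveI : SMulCommClass G Γ(Q, V) Γ(X, p ⁻¹ᵁ V) :=
    ⟨fun g a b => by
      change ρ.act g V (p.app V a * b) = p.app V a * ρ.act g V b
      exact ρ.act_app_mul g V a b⟩
  haveI : Algebra.IsInvariant Γ(Q, V) Γ(X, p ⁻¹ᵁ V) G :=
    ⟨fun b hb => hq.exists_app_eq V b fun g _ => hb g⟩
  haveI : FaithfulSMul Γ(Q, V) Γ(X, p ⁻¹ᵁ V) :=
    (faithfulSMul_iff_algebraMap_injective _ _).mpr (hq.app_injective V)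
  have hfree' : ∀ g : G, g ≠ 1 →
      Ideal.span (Set.range fun b : Γ(X, p ⁻¹ᵁ V) ↦ g • b - b) = ⊤ := hfree V hV
  -- the module `M = Γ(E, p⁻¹V)` with its descent datum `g • m = (g⁻¹) · m`
  letI : Module Γ(Q, V) Γ(E, p ⁻¹ᵁ V) := Module.compHom _ (p.app V).hom
  haveI : IsScalarTower Γ(Q, V) Γ(X, p ⁻¹ᵁ V) Γ(E, p ⁻¹ᵁ V) :=
    ⟨fun a b m => mul_smul (p.app V a) b m⟩
  letI : DistribMulAction G Γ(E, p ⁻¹ᵁ V) :=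
    { smul := fun g m => ρ.actSections E φ g⁻¹ V m
      one_smul := fun m => by
        change ρ.actSections E φ 1⁻¹ V m = m
        rw [inv_one]; exact ρ.actSections_one E φ hunit V m
      mul_smul := fun g h m => by
        change ρ.actSections E φ (g * h)⁻¹ V m =
          ρ.actSections E φ g⁻¹ V (ρ.actSections E φ h⁻¹ V m)
        rw [mul_inv_rev]; exact ρ.actSections_mul E φ hcocycle h⁻¹ g⁻¹ V m
      smul_zero := fun g => map_zero _
      smul_add := fun g m m' => map_add _ m m' }
  haveI : SMulDistribClass G Γ(X, p ⁻¹ᵁ V) Γ(E, p ⁻¹ᵁ V) :=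
    ⟨fun g b m => by
      change ρ.actSections E φ g⁻¹ V (b • m) = ρ.act g V b • ρ.actSections E φ g⁻¹ V m
      rw [actSections_smul]; rfl⟩
  -- the invariants `N = M^G` and the Chase–Harrison–Rosenberg descent `B ⊗_A N ≅ M`
  obtain ⟨N, hN⟩ :=
    Literature.RingTheory.GaloisAlgebras.exists_submodule_mem_iff_forall_smul_eq Γ(Q, V) G
      (B := Γ(X, p ⁻¹ᵁ V)) (M := Γ(E, p ⁻¹ᵁ V))
  have hbase := Literature.RingTheory.GaloisAlgebras.isBaseChange_of_free Γ(Q, V) G hfree' N hN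
  have hNι : ∀ m : Γ(E, p ⁻¹ᵁ V), m ∈ N ↔ m ∈ Set.range (ι.app V) := by
    intro m
    rw [hN, hι, ρ.mem_range_moduleInvariantsι_app_iff E φ V m]
    constructor
    · intro h g
      have h' := h g⁻¹
      change ρ.actSections E φ g⁻¹⁻¹ V m = m at h'
      rwa [inv_inv] at h'
    · intro h g; exact h g⁻¹
  -- the sections `P = Γ(p^* F, p⁻¹V)` as a `B`-module and an `A`-module
  letI : Module Γ(Q, V) Γ((Scheme.Modules.pullback p).obj F, p ⁻¹ᵁ V) :=
    Module.compHom _ (p.app V).hom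
  haveI : IsScalarTower Γ(Q, V) Γ(X, p ⁻¹ᵁ V) Γ((Scheme.Modules.pullback p).obj F, p ⁻¹ᵁ V) :=
    ⟨fun a b t => mul_smul (p.app V a) b t⟩
  -- the comparison as a `B`-linear map
  let d : Γ((Scheme.Modules.pullback p).obj F, p ⁻¹ᵁ V) →ₗ[Γ(X, p ⁻¹ᵁ V)] Γ(E, p ⁻¹ᵁ V) :=
    { toFun := fun t => (ρ.descentHom E φ).app (p ⁻¹ᵁ V) t
      map_add' := fun t t' => map_add _ t t'
      map_smul' := fun b t => Scheme.Modules.Hom.app_smul _ b t }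
  have hd : ∀ t, d t = (ρ.descentHom E φ).app (p ⁻¹ᵁ V) t := fun _ => rfl
  -- the preimage `x(n) ∈ Γ(F, V)` of an invariant `n`, and `ψ : N → P`, `n ↦ η(x(n))`
  have hx : ∀ n : N, ∃ x : Γ(F, V), ι.app V x = (n : Γ(E, p ⁻¹ᵁ V)) :=
    fun n => (hNι n).mp n.2
  choose x hx using hx
  have hxι : ∀ (n : N) (y : Γ(F, V)), ι.app V y = (n : Γ(E, p ⁻¹ᵁ V)) → y = x n :=
    fun n y hy => ρ.moduleInvariantsι_app_injective E φ V (hy.trans (hx n).symm)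
  let ψ : N →ₗ[Γ(Q, V)] Γ((Scheme.Modules.pullback p).obj F, p ⁻¹ᵁ V) :=
    { toFun := fun n => unitSection p F V (x n)
      map_add' := fun n n' => by
        have h : x (n + n') = x n + x n' :=
          (hxι (n + n') (x n + x n') (by rw [map_add, hx, hx]; rfl)).symm
        rw [h, unitSection_add]
      map_smul' := fun a n => by
        have h : x (a • n) = a • x n := by
          refine (hxι (a • n) (a • x n) ?_).symm
          rw [Scheme.Modules.Hom.app_smul, hx]; rfl
        rw [h, unitSection_smul]; rfl }
  have hψ : ∀ n : N, ψ n = unitSection p F V (x n) := fun _ => rfl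
  -- `d (ψ n) = n`
  have hdψ : ∀ n : N, d (ψ n) = (n : Γ(E, p ⁻¹ᵁ V)) := fun n => by
    rw [hψ, hd, descentHom_app_unitSection, ← hι, hx]
  -- the inverse `M → P` from the universal property of `B ⊗_A N ≅ M`
  let l := hbase.lift ψ
  have hl : ∀ n : N, l (n : Γ(E, p ⁻¹ᵁ V)) = ψ n := fun n => hbase.lift_eq ψ n
  -- `l ∘ d = id`: check on the generators `c • η(x)`
  have h1 : ∀ t, l (d t) = t := by
    intro t
    refine pullback_sections_induction p F hV (ρ.isAffineLocalizing_moduleInvariants E φ hE)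
      (P := fun t => l (d t) = t) (by rw [map_zero, map_zero])
      (fun s s' hs hs' => by rw [map_add, map_add, hs, hs']) (fun c y => ?_) t
    rw [unitSectionLE_refl, map_smul, map_smul]
    have hn : (ι.app V y : Γ(E, p ⁻¹ᵁ V)) ∈ N := (hNι _).mpr ⟨y, rfl⟩
    have hdy : d (unitSection p F V y) = ((⟨ι.app V y, hn⟩ : N) : Γ(E, p ⁻¹ᵁ V)) := by
      rw [hd, descentHom_app_unitSection]
    rw [hdy, hl, hψ, ← hxι ⟨ι.app V y, hn⟩ y rfl]
  -- `d ∘ l = id`: two `B`-linear maps agreeing on `N`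
  have h2 : ∀ m, d (l m) = m := by
    intro m
    have h := hbase.algHom_ext (d ∘ₗ l) LinearMap.id fun n => by
      rw [LinearMap.comp_apply, LinearMap.id_apply, Submodule.subtype_apply, hl, hdψ]
    exact LinearMap.congr_fun h m
  refine ⟨fun t t' h => ?_, fun m => ⟨l m, (hd _).symm.trans (h2 m)⟩⟩
  have h' := congrArg l (show d t = d t' from h)
  rwa [h1, h1] at h'

/-! ### The global statements -/

/-- **`p^* (p_* E)^G ⟶ E` is an isomorphism** for an affine geometric quotient `p` by a free action
and a quasi-coherent `E` with an equivariant structure (bijective on the sections over the affine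
cover `p⁻¹V`, `V ⊆ Q` affine). [cite: MumfordAV1970, §12 Thm. 1] -/
theorem isIso_descentHom [IsAffineHom p] (hq : ρ.IsGeometricQuotient p)
    (hfree : ∀ (V : Q.Opens), IsAffineOpen V → ∀ g : G, g ≠ 1 →
      Ideal.span (Set.range fun b : Γ(X, p ⁻¹ᵁ V) ↦ ρ.act g V b - b) = ⊤)
    (hE : IsAffineLocalizing E)
    (hunit : (φ 1).hom = ((Scheme.Modules.pullbackCongr ρ.aut_one_hom).app E).hom ≫
      ((Scheme.Modules.pullbackId X).app E).hom)
    (hcocycle : ∀ g h : G, (φ (g * h)).hom =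
      ((Scheme.Modules.pullbackCongr (ρ.aut_mul_hom g h)).app E).hom ≫
        ((Scheme.Modules.pullbackComp (ρ.aut h).hom (ρ.aut g).hom).app E).inv ≫
          (Scheme.Modules.pullback (ρ.aut h).hom).map (φ g).hom ≫ (φ h).hom) :
    IsIso (ρ.descentHom E φ) := by
  refine isIso_of_app_bijective_of_cover (ρ.descentHom E φ)
    (IsAffineLocalizing.pullback p (ρ.isAffineLocalizing_moduleInvariants E φ hE)) hE
    (fun V : Q.affineOpens => p ⁻¹ᵁ (V : Q.Opens)) (fun V => V.2.preimage p) ?_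
    (fun V => ρ.descentHom_app_bijective E φ hq hfree hE hunit hcocycle V.2)
  rw [← Scheme.Hom.preimage_iSup, iSup_affineOpens_eq_top Q]
  rfl

/-- **Compatibility of `p^* (p_* E)^G ≅ E` with the equivariant structures**: the comparison
intertwines the canonical structure `(ρ.aut g)^* p^* F ≅ (ρ.aut g ≫ p)^* F = p^* F` on the
pull-back with `φ` — checked on the doubly pulled-back sections `η_{ρ.aut g}(η_p(x))`, where both
sides give the invariant section `ι(x)`. [cite: MumfordAV1970, §12 Thm. 1] -/
theorem pullback_map_descentHom_comp (g : G) :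
    (Scheme.Modules.pullback (ρ.aut g).hom).map (ρ.descentHom E φ) ≫ (φ g).hom =
      ((Scheme.Modules.pullbackComp (ρ.aut g).hom p).app (ρ.moduleInvariants E φ) ≪≫
        (Scheme.Modules.pullbackCongr (ρ.aut_comp g)).app (ρ.moduleInvariants E φ)).hom ≫
          ρ.descentHom E φ := by
  set F := ρ.moduleInvariants E φ with hF
  -- both sides are morphisms `(ρ.aut g)^* (p^* F) ⟶ E`; compare their adjuncts `p^* F ⟶ (ρ.aut g)_* E`,
  -- which are determined by their values on the sections `η_p(x)`
  apply Literature.AlgebraicGeometry.HodgeTheory.pullbackObj_hom_ext_unitSection (ρ.aut g).hom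
    ((Scheme.Modules.pullback p).obj F)
  intro W y
  -- reduce to `y = η_p(x)` restricted: compare the two morphisms `p^* F ⟶ (ρ.aut g)_* E`
  revert W y
  suffices hθ : ((Scheme.Modules.pullbackPushforwardAdjunction (ρ.aut g).hom).homEquiv _ E)
      ((Scheme.Modules.pullback (ρ.aut g).hom).map (ρ.descentHom E φ) ≫ (φ g).hom) =
      ((Scheme.Modules.pullbackPushforwardAdjunction (ρ.aut g).hom).homEquiv _ E)
      (((Scheme.Modules.pullbackComp (ρ.aut g).hom p).app F ≪≫
        (Scheme.Modules.pullbackCongr (ρ.aut_comp g)).app F).hom ≫ ρ.descentHom E φ) by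
    intro W y
    have h := congrArg (fun ψ => (Scheme.Modules.Hom.app ψ W) y) hθ
    simp only [Adjunction.homEquiv_unit, Scheme.Modules.Hom.comp_app, CategoryTheory.comp_apply,
      Scheme.Modules.pushforward_map_app] at h
    exact h
  apply Literature.AlgebraicGeometry.HodgeTheory.pullbackObj_hom_ext_unitSection p F
  intro V x
  simp only [Adjunction.homEquiv_unit, Scheme.Modules.Hom.comp_app, CategoryTheory.comp_apply,
    Scheme.Modules.pushforward_map_app, Iso.trans_hom, Iso.app_hom]
  -- now both sides are evaluated at `η_{ρ.aut g}(η_p(x))`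
  change (φ g).hom.app _ (((Scheme.Modules.pullback (ρ.aut g).hom).map (ρ.descentHom E φ)).app _
      (unitSection (ρ.aut g).hom _ (p ⁻¹ᵁ V) (unitSection p F V x))) =
    (ρ.descentHom E φ).app _ (((Scheme.Modules.pullbackCongr (ρ.aut_comp g)).hom.app F).app _
      (((Scheme.Modules.pullbackComp (ρ.aut g).hom p).hom.app F).app _
        (unitSection (ρ.aut g).hom _ (p ⁻¹ᵁ V) (unitSection p F V x))))
  rw [pullback_map_app_unitSection, descentHom_app_unitSection, pullbackComp_hom_app_unitSection]
  have hcg : ((Scheme.Modules.pullbackCongr (ρ.aut_comp g)).hom.app F).app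
        ((ρ.aut g).hom ⁻¹ᵁ (p ⁻¹ᵁ V)) (unitSection ((ρ.aut g).hom ≫ p) F V x) =
      ((Scheme.Modules.pullback p).obj F).presheaf.map
        (eqToHom (ρ.preimage_preimage g V)).op (unitSection p F V x) :=
    pullbackCongr_hom_app_unitSection F (ρ.aut_comp g) V x
  rw [hcg, app_presheaf_map, descentHom_app_unitSection]
  -- left: `φ_g(η(ι x))` is the action `g · ι x = ι x` up to transport
  have hinv := ρ.actSections_moduleInvariantsι_app E φ g V x
  rw [actSections_eq] at hinv
  have hinj : Function.Injective
      (E.presheaf.map (eqToHom (ρ.preimage_preimage g V).symm).op) :=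
    (E.presheaf.mapIso (eqToIso (ρ.preimage_preimage g V).symm).op).addCommGroupIsoToAddEquiv.injective
  apply hinj
  change E.presheaf.map (eqToHom (ρ.preimage_preimage g V).symm).op
      ((φ g).hom.app _ (unitSection (ρ.aut g).hom E (p ⁻¹ᵁ V) ((ρ.moduleInvariantsι E φ).app V x))) = _
  rw [hinv]
  exact ((presheaf_map_map_congr E _ _ (𝟙 _) _).trans (presheaf_map_self E _ _)).symm

/-- **(T1) Galois descent of quasi-coherent modules along a free finite quotient — EXISTENCE.**
For a finite group `G` acting on `X` over `Q` such that `p : X ⟶ Q` is an affine geometric quotient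
(`IsGeometricQuotient`, `IsAffineHom`; e.g. the tree's `toQuotient`) and the action is free on
the affine charts `p⁻¹V` (Chase–Harrison–Rosenberg), every quasi-coherent `E` on `X` with a
`G`-equivariant structure `φ` (unit and cocycle conditions `hunit`, `hcocycle`) is the pull-back
of a quasi-coherent `F` on `Q` — namely `F = (p_* E)^G` — compatibly with the equivariant
structures. ([MFK94] Ch. 1 §3 / Prop. 7.1 for the `G`-torsor `X → X/G`; Mumford AV §12 Thm. 1;
SGA 1 VIII 1.1; chartwise Greither LNM 1534 Ch. 0 Thm. 7.1 = `GaloisAlgebras.isBaseChange_of_free`.)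
[cite: MumfordAV1970, §12 Thm. 1] -/
theorem exists_descent_of_free [IsAffineHom p] (hq : ρ.IsGeometricQuotient p)
    (hfree : ∀ (V : Q.Opens), IsAffineOpen V → ∀ g : G, g ≠ 1 →
      Ideal.span (Set.range fun b : Γ(X, p ⁻¹ᵁ V) ↦ ρ.act g V b - b) = ⊤)
    [E.IsQuasicoherent]
    (hunit : (φ 1).hom = ((Scheme.Modules.pullbackCongr ρ.aut_one_hom).app E).hom ≫
      ((Scheme.Modules.pullbackId X).app E).hom)
    (hcocycle : ∀ g h : G, (φ (g * h)).hom =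
      ((Scheme.Modules.pullbackCongr (ρ.aut_mul_hom g h)).app E).hom ≫
        ((Scheme.Modules.pullbackComp (ρ.aut h).hom (ρ.aut g).hom).app E).inv ≫
          (Scheme.Modules.pullback (ρ.aut h).hom).map (φ g).hom ≫ (φ h).hom) :
    ∃ (F : Q.Modules) (_ : F.IsQuasicoherent) (e : (Scheme.Modules.pullback p).obj F ≅ E),
      ∀ g : G, (Scheme.Modules.pullback (ρ.aut g).hom).map e.hom ≫ (φ g).hom =
        ((Scheme.Modules.pullbackComp (ρ.aut g).hom p).app F ≪≫
          (Scheme.Modules.pullbackCongr (ρ.aut_comp g)).app F).hom ≫ e.hom := by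
  have hE : IsAffineLocalizing E := IsAffineLocalizing.of_isQuasicoherent E
  haveI := ρ.isIso_descentHom E φ hq hfree hE hunit hcocycle
  exact ⟨ρ.moduleInvariants E φ,
    isQuasicoherent_of_isAffineLocalizing (ρ.isAffineLocalizing_moduleInvariants E φ hE),
    asIso (ρ.descentHom E φ), fun g => ρ.pullback_map_descentHom_comp E φ g⟩

end Literature.AlgebraicGeometry.RelativeSpec.ActionOver
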